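import Literature.Analysis.FunctionSpaces.Complexify
import Literature.Analysis.FunctionSpaces.TorusSobolevNorm
import Literature.Analysis.FunctionSpaces.TorusFluidGlue
import HarnessLib

/-!
# Barrier: two distinct global SMOOTH solutions from one critical (`BMO⁻¹`) datum
(Coiculescu–Palasek 2025)

Barrier catalogue entry for `NavierStokesRegularity` (D-0021). Vendors, as a named fact in a
deliberately weakened but faithful form (see *Rendering*), Theorem 1.2 with Remark 1.3 of
M. P. Coiculescu, S. Palasek, *Non-uniqueness of smooth solutions of the Navier–Stokes equations
from critical data*, Invent. Math. 244 (2025), 165–219 (arXiv:2503.14699), over the accepted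
torus vocabulary `Literature.Analysis.FunctionSpaces.Torus.IsClassicalNSSolutionOn`, `Literature.Analysis.FunctionSpaces.Torus.IsSmooth`,
`Literature.Analysis.FunctionSpaces.Torus.HasZeroMean`, and the spectral `Ḣ^{-1}(𝕋³)` seminorm `Literature.Torus.eHomSobolevSeminorm (-1)`
/ `Literature.Analysis.FunctionSpaces.Torus.ContinuousInSobolevOn` (`Literature/Analysis/FunctionSpaces/`).

## What is printed

* Thm. 1.1 (Koch–Tataru 2001, recalled): small divergence-free `BMO⁻¹` data have a unique global
  solution regular for `t > 0`.
* Thm. 1.2: there exists divergence-free initial data `U⁰ ∈ BMO⁻¹` such that the Cauchy problem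
  (NSE) (`ν = 1`, on `𝕋³ = ℝ³/(2πℤ)³`, Rmk. 1.7) admits two distinct global solutions
  `u⁽¹⁾, u⁽²⁾ ∈ C^∞_{t,x}((0,∞) × 𝕋³) ∩ L^∞([0,∞); BMO⁻¹(𝕋³)) ∩ C⁰([0,∞); Ẇ^{-1,p}(𝕋³))` for
  all `p < ∞`.
* Rmk. 1.3: both solutions lie in Koch–Tataru's path space,
  `sup_{t>0} t^{1/2}‖u(t)‖_{L^∞} + (Carleson part) < ∞`; "the only difference is that they are
  not perturbative around zero"; abstract: "sharpness of the celebrated small data global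
  well-posedness result of Koch and Tataru".
* Rmk. 1.5: the solutions are NOT Leray–Hopf (the datum has infinite energy); Rmk. 1.6: `U⁰` is
  smooth outside a null set; §1.1: table of well-posedness versus ill-posedness in the critical chain
  `Ḣ^{1/2} ⊂ L³ ⊂ B^{-1+3/p}_{p,∞} ⊂ BMO⁻¹ ⊂ B^{-1}_{∞,∞}` (Bourgain–Pavlović, Germain, Yoneda,
  Wang).

## Rendering (weaker than print, implied by it)

The tree has no `BMO⁻¹(𝕋³)` and no `Ẇ^{-1,p}(𝕋³)` for `p ≠ 2`, and the datum `U⁰` is a genuine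
distribution (a lacunary series, §1.3.1); for `p = 2`, `Ẇ^{-1,2}(𝕋³) = Ḣ^{-1}(𝕋³)` IS available as
the spectral seminorm `Torus.eHomSobolevSeminorm (-1)`. The fact below therefore keeps the
following consequences of Thm. 1.2 / Rmk. 1.3, all over accepted notions: two classical solutions
`(u, p₁)`, `(v, p₂)` of the unforced equations (`ν = 1`) on `(0, ∞) × 𝕋³` (smooth solutions on
the torus have smooth pressures), each obeying the first Koch–Tataru bound
`sup_{t>0} √t ‖u(t)‖_∞ < ∞` (Rmk. 1.3), each continuous in `H^{-1}` at positive times, distinct at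
some positive time, and with THE SAME initial datum in the sense of `p = 2`:
`‖u(t) - v(t)‖_{Ḣ^{-1}} → 0` and each of `u(t)`, `v(t)` Cauchy in `Ḣ^{-1}` as `t → 0⁺` (from
`u⁽ⁱ⁾ ∈ C⁰([0,∞); Ẇ^{-1,2})` with the common value `U⁰`); the weaker distributional form —
pairings against smooth mean-zero fields converge and their difference tends to `0` — is kept as
additional conjuncts (also implied by print). The `2π`-periodic setting is transported to
`UnitAddTorus (Fin 3)` by the Navier–Stokes scaling `x ↦ 2πx`, `t ↦ 4π²t`, which keeps `ν = 1`.
NOT rendered (print-only): the `BMO⁻¹` datum itself, `L^∞_t BMO⁻¹`, and the Carleson half of the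
Koch–Tataru norm.

## Audit 2026-08-16 (refuter barrier audit, D-0021): formal fact confirmed, claimed coverage narrowed

* The formal fact is faithful (weaker than print), non-vacuous and admits no junk witness: the
  global `√t`-bound forces zero mean of both witnesses (conserved mean, `t → ∞`), which is what
  excludes the Galilean-boost / constant-field witnesses that the `Ḣ⁻¹`-SEMInorm and mean-zero
  pairing clauses alone would admit (`hasZeroMean_of_sqrt_mul_norm_le`, companion file
  `CriticalDataSmoothNonuniquenessNarrow`); the two `ContinuousInSobolevOn (Ioi 0) (-1)`
  conjuncts are implied by the classical-solution conjuncts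
  (`continuousInSobolevOn_complexify_of_isSmoothSpaceTimeOn`, sibling `…Proofs` file) and are
  kept for readability. In the tree the fact is reduced to the principal-part estimates of the
  paper (`CriticalDataSmoothNonuniqueness_of_principalParts`, sibling files).
* COVERAGE. Of the tagged classes `koch-tataru-class-uniqueness`, `mild-solution-uniqueness`,
  `critical-space-wellposedness`, the printed theorem refutes uniqueness ONLY for solution
  classes without norm-continuity at `t = 0⁺` into the critical space (`L^∞_t BMO⁻¹`, not
  `C_t BMO⁻¹`; "not perturbative around zero", Rmk. 1.3) and for ONE datum outside the
  `BMO⁻¹`-closure of `L^∞` (level-independent block sizes, §1.3.2). Untouched: uniqueness of mild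
  solutions in `C([0,T); bmo⁻¹) ∩ L^∞_loc((0,T); L^∞)` (Miura 2005, Thm. 2.3), in `C([0,T); L³)`
  (Furioli–Lemarié-Rieusset–Terraneo 2000; Lions–Masmoudi 2001) and in `C_t Ḃ^{3/p-1}_{p,q}`,
  `p < 3` or `p = 3, q ≤ 2` (Fujii 2026, Prop. 1.1) — classes containing every solution smooth
  on `[0,T)` from smooth data — and Koch–Tataru's LARGE-data local theory for data in the
  closure of bounded functions in `bmo⁻¹` (Lemarié-Rieusset 2016, Thm. 9.2 and pp. 198–199,
  236–237). The exact refuted principle, over the accepted vocabulary, is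
  `CriticalDataSmoothNonuniquenessNarrow`; `criticalDataSmoothNonuniqueness_iff_not_unique` shows
  the catalogue fact is equivalent to its failure. Neighbouring entries covering what this one
  does not: `InstantaneousTypeIBlowup` (Cheskidov–Dai–Palasek 2025: a second solution, classical
  for `t > 0`, from EVERY smooth datum), `CriticalBesovSteadyNonuniqueness` (Fujii 2026: rough
  mild solutions from the zero datum, `ℝ³` and `𝕋³`).
* SCOPE UPDATES. The `𝕋²` analogue left open in Rmk. 1.7 is claimed in C. Miao, Y. Nie et al.,
  arXiv:2602.19074 (2026), Thm. 1.1; `ℝ³`/`ℝ²` remain "expected".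

## References

* M. P. Coiculescu, S. Palasek, Invent. Math. 244 (2025), 165–219; arXiv:2503.14699.
  [`CoiculescuPalasek2025`]
* H. Koch, D. Tataru, Adv. Math. 157 (2001). [`KochTataruAdvMath2001`]
* H. Jia, V. Šverák, Invent. Math. 196 (2014); J. Funct. Anal. 268 (2015). [`JiaSverak2014`, `JiaSverak2015`]
* J. Bourgain, N. Pavlović, J. Funct. Anal. 255 (2008). [`BourgainPavlovic2008`]
* H. Miura, J. Funct. Anal. 218 (2005), 110–129. [`Miura2005`]
* P. G. Lemarié-Rieusset, *The Navier–Stokes Problem in the 21st Century*, CRC 2016. [`LemarieRieusset2016`]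
* G. Furioli, P. G. Lemarié-Rieusset, E. Terraneo, Rev. Mat. Iberoam. 16 (2000). [`FurioliLemarierieussetTerraneo2000`]
* M. Fujii, arXiv:2602.19846 (2026). [`Fujii2026`]
* A. Cheskidov, M. Dai, S. Palasek, arXiv:2511.09556 (2025). [`CheskidovDaiPalasek2025`]
-/

noncomputable section

open MeasureTheory Set Filter Topology
open scoped InnerProductSpace RealInnerProductSpace

namespace Literature.Barriers.NavierStokesRegularity

/-- Local notation for the flat 3-torus `𝕋³ = (ℝ/ℤ)³`. -/
local notation "𝕋³" => UnitAddTorus (Fin 3)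
/-- Local notation for the value space `ℝ³`. -/
local notation "ℝ³" => EuclideanSpace ℝ (Fin 3)

/-- **Barrier (Coiculescu–Palasek 2025): non-uniqueness of global smooth solutions from a
critical datum; sharpness of Koch–Tataru.** There are two classical solutions `(u, p₁)`,
`(v, p₂)` of the unforced Navier–Stokes equations with `ν = 1` on `(0,∞) × 𝕋³` (accepted
`Literature.Torus.IsClassicalNSSolutionOn (Ioi 0)`), both obeying the Koch–Tataru-type bound
`√t ‖u(t)‖_{L^∞} ≤ M` for all `t > 0`, both continuous in `H^{-1}(𝕋³)` at positive times,
which differ at some positive time, and which issue from the same initial datum: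
`‖u(t) - v(t)‖_{Ḣ^{-1}(𝕋³)} → 0` and `u(t)`, `v(t)` are Cauchy in `Ḣ^{-1}` as `t → 0⁺`
(the `p = 2` instance of `C⁰([0,∞); Ẇ^{-1,p})` with common value `U⁰`), and, distributionally,
for every smooth mean-zero test field `φ` the pairings `∫ ⟪u(t), φ⟫`, `∫ ⟪v(t), φ⟫` converge
and `∫ ⟪u(t) - v(t), φ⟫ → 0`. In print the common datum is an explicit divergence-free
`U⁰ ∈ BMO⁻¹(𝕋³)` and the solutions are moreover in `L^∞_t BMO⁻¹ ∩ C⁰_t Ẇ^{-1,p}`, all `p < ∞`, and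
in the full Koch–Tataru path space (see the module docstring for what is not rendered).
[cite: CoiculescuPalasek2025, Thm. 1.2 and Rmk. 1.3]

BARRIER (structured block, D-0021):
technique_class: critical-space-wellposedness large-data-perturbative-theory koch-tataru-class-uniqueness smooth-solution-selection mild-solution-uniqueness critical-spaces mild-solutions uniqueness-without-critical-norm-time-continuity large-bmo-inverse-data-global-wellposedness
blocks: the large-data extension of the in-tree Koch–Tataru theorem `Literature.Analysis.FluidPDE.koch_tataru` with its path norm `Literature.Analysis.FluidPDE.eKochTataruNorm` (ns.S15, stated on `ℝ³`; the present result is on `𝕋³`, cf. Rmk. 1.7: small divergence-free `BMO⁻¹` data have a unique global solution in the Koch–Tataru class, regular for `t > 0`) [cite: KochTataruAdvMath2001, Thm. 2]: for large `BMO⁻¹` data uniqueness fails in exactly that path space — "sharpness of the celebrated small data global well-posedness result of Koch and Tataru", "the first example of non-uniqueness for the Navier–Stokes equations with data at the critical regularity" [cite: CoiculescuPalasek2025, abstract, Thm. 1.2 and Rmk. 1.3]; hence any strengthening of NavierStokesRegularity asserting global well-posedness (existence + uniqueness of solutions smooth for `t > 0`) from ALL divergence-free `BMO⁻¹` data. (audit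 2026-08-16) PRECISELY: what is blocked of `koch_tataru` is the removal of its SMALLNESS hypothesis while keeping membership in the path space (even with the global bound `sup_{t>0} √t‖u(t)‖_∞ < ∞`) as the whole uniqueness class; NOT blocked are Koch–Tataru's own large-data LOCAL theorem for data in the closure of bounded functions in `bmo⁻¹` (unique in the small ball of `E_T`) [cite: LemarieRieusset2016, Thm. 9.2 and the criteria following it (pp. 198–199)], uniqueness under norm-continuity at `t = 0⁺` into the critical space [cite: Miura2005, Thm. 2.3], and the existence half of "well-posedness" (both printed solutions exist globally); the exact refuted principle in the formal class is `CriticalDataSmoothNonuniquenessNarrow` (companion file).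
because: the datum is a lacunary series `U⁰ = Σ_k V_k⁰` of Fourier-localised blocks at super-exponentially separated frequencies `N_k`; at each level two forward evolutions are consistent with (NSE) up to small errors — a heat-dominated flow and a flow in which the level-`k+1` block first drives level `k` through the low-frequency part of the quadratic interaction — and pairing the levels in the two possible ways gives two genuinely different approximate solutions, corrected to exact ones by a fixed point in a slightly subcritical norm (a mechanism transplanted from Palasek's dyadic-model non-uniqueness) [cite: CoiculescuPalasek2025, §1.3].
evasions_known: finite-energy / Leray–Hopf data: the construction needs infinite energy and the solutions are not Leray–Hopf [cite: CoiculescuPalasek2025, Rmk. 1.5]; SMALL critical data retain uniqueness [cite: KochTataruAdvMath2001, Thm. 2]; the whole-space `ℝ³` version is expected but not carried out [cite: CoiculescuPalasek2025, Rmk. 1.7]. (audit 2026-08-16) (a) NORM-CONTINUITY AT `t = 0⁺` IN THE CRITICAL SPACE: mild solutions in `C([0,T); bmo⁻¹(ℝ³)) ∩ L^∞_loc((0,T); L^∞)` with `vmo⁻¹` data are unique — "Behavior of the solution near `t = 0` plays an essential role for validity of uniqueness of mild solutions" [cite: Miura2005, §1 and Thm. 2.3]; likewise `C([0,T); L³(ℝ³))`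 [cite: FurioliLemarierieussetTerraneo2000, Thm. 1] and `C([0,T); Ḃ^{3/p-1}_{p,q}(ℝ³))` for `p < 3` or `p = 3, q ≤ 2` [cite: Fujii2026, Prop. 1.1]; the printed solutions are only `L^∞([0,∞); BMO⁻¹)`, continuous at `0` in the supercritical `Ẇ^{-1,p}`, `p < ∞`, and "not perturbative around zero" [cite: CoiculescuPalasek2025, Thm. 1.2 and Rmk. 1.3], the authors themselves listing Miura's and related classes as well-behaved [cite: CoiculescuPalasek2025, Rmk. 1.4]; every solution smooth on `[0,T) × 𝕋³` from smooth data lies in Miura's class; (b) `vmo⁻¹`-TYPE DATA / the little Koch–Tataru space: for `u₀` in the closure of bounded (or test) functions in `bmo⁻¹` — containing `L³`, `Ḣ^{1/2}`, `Ḃ^{-1+3/p}_{p,q<∞}`, all smooth data, but no non-zero scale-invariant datum and (one checks, from the level-independent block sizes of §1.3.2) not the Coiculescu–Palasek datum — `lim_{T→0}‖1_{0<t<T}e^{νtΔ}u₀‖_{E_T} = 0`, so Koch–Tataru's fixed point gives a local solution for arbitrarily LARGE such data, unique in the ball `‖u‖_{E_T} ≤ C₀ε₀` [cite: LemarieRieusset2016,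 Thm. 9.2 and pp. 198–199], and the Brezis–Miura argument identifies every `BMO⁻¹`-continuous, bounded-for-`t>0` solution with it [cite: LemarieRieusset2016, proof of Thm. 9.11 (pp. 236–237, footnote 2)]; (c) NOT an evasion: smoothness of the datum alone (a second solution classical for `t > 0` with Type-I growth at `0⁺` issues from EVERY smooth datum on `𝕋ᵈ` [cite: CheskidovDaiPalasek2025, Thm. 1.1]; entry `InstantaneousTypeIBlowup`), nor continuity in a critical Besov norm without boundedness for `t > 0` (rough mild solutions from the zero datum [cite: Fujii2026, Thm. 1.2 and Rmk. 1.3]; entry `CriticalBesovSteadyNonuniqueness`) — Miura's two hypotheses are separately necessary.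
scope_caveats: (i) printed on the torus `𝕋³ = ℝ³/(2πℤ)³` only; the `ℝ³` case (setting of Clay (A) = NavierStokesRegularity and of `Literature.Analysis.FluidPDE.koch_tataru`) is "expected" but not proved [cite: CoiculescuPalasek2025, Rmk. 1.7]; (ii) the datum has INFINITE energy and is smooth only outside a null set, the two solutions are NOT Leray–Hopf: nothing is asserted about uniqueness from `L²`, `L³`, `Ḣ^{1/2}` or Schwartz data (for Clay data local smooth solutions are unique) [cite: CoiculescuPalasek2025, Rmks. 1.5–1.6]; (iii) the Lean rendering is WEAKER than printed: only the `L^∞` half `√t‖u(t)‖_∞ ≤ M` of the Koch–Tataru norm is kept — the Carleson half of `‖·‖_{X_KT}`, the class `L^∞_t BMO⁻¹` and the `BMO⁻¹` datum `U⁰` itself are print-only, and the common datum is expressed through `Ḣ^{-1}` (`p = 2`) convergence plus distributional pairings — so the FORMAL fact establishes non-uniqueness only in the strictly larger class "classical on `(0,∞)`, `√t`-`L^∞`-bounded, common `Ḣ^{-1}` datum"; "uniqueness fails in exactly the Koch–Tataru path space" and "sharpness of Koch–Tataru" are carried by the citation, not by the Lean text [cite: CoiculescuPalasek2025, Thm.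 1.2 and Rmk. 1.3]; (iv) a NON-UNIQUENESS statement: both solutions are global and smooth for `t > 0`, so it says nothing towards blow-up; the `2π`-torus is transported to `UnitAddTorus (Fin 3)` by scaling. (v) (audit 2026-08-16) technique-class coverage is narrower than the tags: of `koch-tataru-class-uniqueness` / `mild-solution-uniqueness` / `critical-space-wellposedness` only uniqueness in classes WITHOUT norm-continuity at `t = 0⁺` into the critical space, from ONE datum outside the `BMO⁻¹`-closure of `L^∞`, is refuted; see `evasions_known` (a)–(b) and the companion `CriticalDataSmoothNonuniquenessNarrow` / `criticalDataSmoothNonuniqueness_iff_not_unique`, which state the exact refuted principle over the accepted vocabulary and prove the catalogue fact equivalent to its failure [cite: Miura2005, Thm. 2.3] [cite: CoiculescuPalasek2025, Thm. 1.2 and Rmk. 1.3]; (vi) (audit) the `𝕋²` analogue left open in Rmk. 1.7 is claimed by C. Miao, Y. Nie et al., arXiv:2602.19074 (2026), Thm. 1.1; `ℝ³`/`ℝ²` remain "expected" [cite: CoiculescuPalasek2025, Rmk. 1.7]; (vii) (audit) formal remarks: the global `√t`-bound forces zero mean of both witnesses (conserved mean; this is what excludes Galilean / constant junk witnesses of the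 `Ḣ⁻¹`-seminorm datum clauses), and the two `ContinuousInSobolevOn (Ioi 0) (-1)` conjuncts follow from the classical-solution conjuncts (sibling `…Proofs` file) — decoration kept for readability; in the tree the fact is reduced to the paper's principal-part estimates (`CriticalDataSmoothNonuniqueness_of_principalParts`).
status: established; claimed coverage narrowed by the audit of 2026-08-16 (`CriticalDataSmoothNonuniquenessNarrow.lean`); in the tree reduced to the principal-part estimates (sibling files) -/
def CriticalDataSmoothNonuniqueness : Prop :=
  ∃ (u v : ℝ → 𝕋³ → ℝ³) (p₁ p₂ : ℝ → 𝕋³ → ℝ),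
    Literature.Analysis.FunctionSpaces.Torus.IsClassicalNSSolutionOn (Ioi 0) 1 0 u p₁ ∧ Literature.Analysis.FunctionSpaces.Torus.IsClassicalNSSolutionOn (Ioi 0) 1 0 v p₂ ∧
    (∃ M : ℝ, ∀ t : ℝ, 0 < t → ∀ x, Real.sqrt t * ‖u t x‖ ≤ M ∧ Real.sqrt t * ‖v t x‖ ≤ M) ∧
    Literature.Analysis.FunctionSpaces.Torus.ContinuousInSobolevOn (Ioi 0) (-1) (fun t => Literature.Analysis.FunctionSpaces.EuclideanSpace.complexify ∘ u t) ∧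
    Literature.Analysis.FunctionSpaces.Torus.ContinuousInSobolevOn (Ioi 0) (-1) (fun t => Literature.Analysis.FunctionSpaces.EuclideanSpace.complexify ∘ v t) ∧
    (∃ t : ℝ, 0 < t ∧ u t ≠ v t) ∧
    Tendsto (fun t => Literature.Analysis.FunctionSpaces.Torus.eHomSobolevSeminorm (-1) (Literature.Analysis.FunctionSpaces.EuclideanSpace.complexify ∘ (u t - v t)))
      (𝓝[>] 0) (𝓝 0) ∧
    Tendsto (fun st : ℝ × ℝ =>
        Literature.Analysis.FunctionSpaces.Torus.eHomSobolevSeminorm (-1) (Literature.Analysis.FunctionSpaces.EuclideanSpace.complexify ∘ (u st.1 - u st.2)))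
      ((𝓝[>] (0 : ℝ)) ×ˢ (𝓝[>] (0 : ℝ))) (𝓝 0) ∧
    Tendsto (fun st : ℝ × ℝ =>
        Literature.Analysis.FunctionSpaces.Torus.eHomSobolevSeminorm (-1) (Literature.Analysis.FunctionSpaces.EuclideanSpace.complexify ∘ (v st.1 - v st.2)))
      ((𝓝[>] (0 : ℝ)) ×ˢ (𝓝[>] (0 : ℝ))) (𝓝 0) ∧
    ∀ φ : 𝕋³ → ℝ³, Literature.Analysis.FunctionSpaces.Torus.IsSmooth φ → Literature.Analysis.FunctionSpaces.Torus.HasZeroMean φ →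
      (∃ c : ℝ, Tendsto (fun t => ∫ x, ⟪u t x, φ x⟫) (𝓝[>] 0) (𝓝 c)) ∧
      (∃ c : ℝ, Tendsto (fun t => ∫ x, ⟪v t x, φ x⟫) (𝓝[>] 0) (𝓝 c)) ∧
      Tendsto (fun t => ∫ x, ⟪u t x - v t x, φ x⟫) (𝓝[>] 0) (𝓝 0)

/-- Reformulation as the failure of a uniqueness principle for the BROADER formal class
(cf. Coiculescu–Palasek 2025, abstract: "sharpness of the … result of Koch and Tataru", printed
for the full Koch–Tataru path space): it is NOT the case that two classical solutions on
`(0,∞) × 𝕋³` obeying `√t‖·‖_∞ ≤ M`, continuous in `H^{-1}` at positive times and with the same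
datum in the `Ḣ^{-1}` sense (`‖u(t) - v(t)‖_{Ḣ^{-1}} → 0` as `t → 0⁺`) must coincide at all
positive times. Proved from the barrier fact. [cite: CoiculescuPalasek2025, Thm. 1.2] -/
theorem CriticalDataSmoothNonuniqueness.not_unique (h : CriticalDataSmoothNonuniqueness) :
    ¬ ∀ (u v : ℝ → 𝕋³ → ℝ³) (p₁ p₂ : ℝ → 𝕋³ → ℝ),
      Literature.Analysis.FunctionSpaces.Torus.IsClassicalNSSolutionOn (Ioi 0) 1 0 u p₁ → Literature.Analysis.FunctionSpaces.Torus.IsClassicalNSSolutionOn (Ioi 0) 1 0 v p₂ →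
      (∃ M : ℝ, ∀ t : ℝ, 0 < t → ∀ x, Real.sqrt t * ‖u t x‖ ≤ M ∧ Real.sqrt t * ‖v t x‖ ≤ M) →
      Literature.Analysis.FunctionSpaces.Torus.ContinuousInSobolevOn (Ioi 0) (-1) (fun t => Literature.Analysis.FunctionSpaces.EuclideanSpace.complexify ∘ u t) →
      Literature.Analysis.FunctionSpaces.Torus.ContinuousInSobolevOn (Ioi 0) (-1) (fun t => Literature.Analysis.FunctionSpaces.EuclideanSpace.complexify ∘ v t) →
      Tendsto (fun t => Literature.Analysis.FunctionSpaces.Torus.eHomSobolevSeminorm (-1) (Literature.Analysis.FunctionSpaces.EuclideanSpace.complexify ∘ (u t - v t)))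
        (𝓝[>] 0) (𝓝 0) →
      ∀ t : ℝ, 0 < t → u t = v t := by
  intro hall
  obtain ⟨u, v, p₁, p₂, hu, hv, hM, hcu, hcv, ⟨t, ht, hne⟩, hdat, -, -, -⟩ := h
  exact hne (hall u v p₁ p₂ hu hv hM hcu hcv hdat t ht)

end Literature.Barriers.NavierStokesRegularity
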